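/-
COR-CM (cell pub-hodgecm2, stage 2 of the Hodge ladder) — count-neutral KERNEL COMBINATORICS «split index-two descent: orbit reduction of the
checklist obligations» (seat prover-pub-hodgecm2-b23-g46-0, binder prover b23, gen 46; claim «SPLIT INDEX-TWO», HOME/INBOX.md l.20957).
Theorems only, on top of `Census/IndexTwoSplitChecklist` BY NAME; no `decide`, no certificate, no named fact, no `sorry`; `Interfaces.lean` (C1),
every E term, B01, `Transposition/*`, `PortJoin/*`, `D2Bridge/*` untouched.
HONEST FRAMING: `HC_CM` is NOT proved, here or anywhere in the tree; nothing here is a period, a count of record or a headline.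
T5: n/a-class (hypothesis binders: `c * c = 1`, `c` central, `c ∈ H`, `H.index = 2`, `x ∉ H`, `x * x = 1`); checker: self.
-/
import Summits.HodgeConjecture.CorCM.Census.IndexTwoSplitChecklist

/-!
# Split index-two descent: orbit reduction of the checklist obligations

Setting of parts I–IV.  The CHECKLIST (`hodgeSpan_le_of_checklist`, `exists_counted_checklist`) asks, for a base-change-stable `N`, that every
TWO-CYCLE FACE `gface Θ t (x·t)` (`Θ` diagonal) and every SQUARE ELEMENT lie in `N`.  Since `N` is base-change stable these obligations are
constant on orbits; this file records the transport formulas a census seat needs to check them on representatives only: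

* §1 base change of a two-cycle face is a two-cycle face: along `h ∈ H` (`mapDomain_rt_coe_twoCycle`) and, in the split case `x·x = 1`,
  along `x·h` (`mapDomain_rt_xmul_twoCycle`: the two places swap cosets, `gface_comm` swaps them back); hence
  **`twoCycle_mem_iff_of_rt`**: `gface Θ t (x t) ∈ N ↔ gface (Θ·Q⁻¹) t' (x t') ∈ N` for the transported place `t'`, every `Q ∈ G`, and the
  reduction **`twoCycle_obligation_of_reps`**: it suffices to check the two-cycle faces at ONE type per diagonal block;
* §2 base change along `h ∈ H` of a mixed face `gface Ψ k (x·l)` is the mixed face `gface (Ψ·h⁻¹) (k h⁻¹) (x·(l h⁻¹))` and deviations go to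
  deviations (`mapDomain_rt_coe_mixed`, `dev_rt_coe`); hence square elements transport along `H` (`square_mem_iff_of_rt_coe`).

## References
* [Pohlmann1968] H. Pohlmann, Algebraic cycles on abelian varieties of complex multiplication type, Ann. of Math. 88 (1968), Thm 1.
-/

namespace Summit.HodgeConjecture.CorCM.Census.IndexTwoDescent

open Finset
open Summit.HodgeConjecture.CorCM.Prior.AllgGroup.RfwfAllgGroup
open Summit.HodgeConjecture.CorCM.Census.BlockParity
open Summit.HodgeConjecture.CorCM.Census.Coinvariant
open Summit.HodgeConjecture.CorCM.Census.ComplementFaces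

noncomputable section

variable {G : Type*} [Group G] [Fintype G] [DecidableEq G] {c : G}
variable {H : Subgroup G} [DecidablePred (· ∈ H)]

/-! ## §1 Two-cycle faces under base change -/

omit [DecidablePred (· ∈ H)] in
/-- **Base change along `h ∈ H` of a two-cycle face**: `(gface Θ t (x t))·h⁻¹ = gface (Θ·h⁻¹) (t h⁻¹) (x (t h⁻¹))`. [folklore] -/
theorem mapDomain_rt_coe_twoCycle (hc2 : c * c = 1) (x : G) (Θ : CMF G c) (t h : H) :
    Finsupp.mapDomain (rt c (h : G)) (gface c hc2 Θ (t : G) (x * (t : G))) =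
      gface c hc2 (rt c (h : G) Θ) ((t * h⁻¹ : H) : G) (x * ((t * h⁻¹ : H) : G)) := by
  rw [mapDomain_rt_gface]
  simp [mul_assoc]

omit [DecidablePred (· ∈ H)] in
/-- **Base change along `x·h` of a two-cycle face** (split case `x·x = 1`): the places swap cosets and the result is again a two-cycle face,
`(gface Θ t (x t))·(x h)⁻¹ = gface (Θ·(x h)⁻¹) t' (x t')` with `t' = x t h⁻¹ x`. [folklore] -/
theorem mapDomain_rt_xmul_twoCycle (hc2 : c * c = 1) (hH : H.index = 2) {x : G} (hx : x ∉ H) (hxx : x * x = 1) (Θ : CMF G c) (t h : H) :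
    Finsupp.mapDomain (rt c (x * (h : G))) (gface c hc2 Θ (t : G) (x * (t : G))) =
      gface c hc2 (rt c (x * (h : G)) Θ) ((⟨x * ((t * h⁻¹ : H) : G) * x, mul_mul_mem hH hx _⟩ : H) : G)
        (x * ((⟨x * ((t * h⁻¹ : H) : G) * x, mul_mul_mem hH hx _⟩ : H) : G)) := by
  rw [mapDomain_rt_gface, gface_comm]
  have hxinv : x⁻¹ = x := inv_eq_of_mul_eq_one_right hxx
  congr 1
  · simp only [Subgroup.coe_mul, Subgroup.coe_inv, mul_inv_rev, hxinv, mul_assoc]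
  · simp only [Subgroup.coe_mul, Subgroup.coe_inv, mul_inv_rev, hxinv, ← mul_assoc, hxx, one_mul]

/-- Diagonal types stay diagonal under base change (split case). [folklore] -/
theorem diagonal_rt (hcH : c ∈ H) (hcen : ∀ g : G, g * c = c * g) (hc2 : c * c = 1) (hH : H.index = 2) {x : G} (hx : x ∉ H)
    (hxx : x * x = 1) (Q : G) {Θ : CMF G c} (hΘ : res₁ hcH hcen x Θ = res₀ hcH Θ) :
    res₁ hcH hcen x (rt c Q Θ) = res₀ hcH (rt c Q Θ) := by
  have h0 : wt (⟨c, hcH⟩ : H) (res₁ hcH hcen x Θ) (res₀ hcH Θ) = 0 := by rw [hΘ]; unfold wt; rw [sdiff_self]; rfl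
  have h := wt_res_rt hcH hcen hc2 hH hx hxx Q Θ
  rw [h0] at h
  exact (eq_of_wt_eq_zero (⟨c, hcH⟩ : H) h).symm

/-- **Two-cycle obligations transport along every base change** (split case): for a base-change-stable `N` and any `Q ∈ G` there is a place
`t'` of `H` with `gface Θ t (x t) ∈ N ↔ gface (Θ·Q⁻¹) t' (x t') ∈ N`. [folklore] -/
theorem exists_twoCycle_mem_iff_of_rt (hc2 : c * c = 1) (hH : H.index = 2) {x : G} (hx : x ∉ H) (hxx : x * x = 1)
    (N : Submodule ℤ (CMF G c →₀ ℤ)) (hN : ∀ Q : G, ∀ y ∈ N, Finsupp.mapDomain (rt c Q) y ∈ N) (Q : G) (Θ : CMF G c) (t : H) :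
    ∃ t' : H, (gface c hc2 Θ (t : G) (x * (t : G)) ∈ N ↔ gface c hc2 (rt c Q Θ) (t' : G) (x * (t' : G)) ∈ N) := by
  have key : ∀ (y : CMF G c →₀ ℤ), (y ∈ N ↔ Finsupp.mapDomain (rt c Q) y ∈ N) := fun y =>
    ⟨hN Q y, fun h => by simpa [mapDomain_rt_inv_mapDomain_rt] using hN Q⁻¹ _ h⟩
  by_cases hQ : Q ∈ H
  · obtain ⟨q, rfl⟩ : ∃ q : H, (q : G) = Q := ⟨⟨Q, hQ⟩, rfl⟩
    exact ⟨t * q⁻¹, by rw [key, mapDomain_rt_coe_twoCycle]⟩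
  · obtain ⟨h, rfl⟩ := exists_eq_mul_of_not_mem hH hx hQ
    exact ⟨⟨x * ((t * h⁻¹ : H) : G) * x, mul_mul_mem hH hx _⟩, by rw [key, mapDomain_rt_xmul_twoCycle hc2 hH hx hxx]⟩

/-- **Two-cycle obligations reduce to one type per diagonal block** (split case): if `N` is base-change stable and contains the two-cycle faces
`gface Θ_b t (x t)` for ONE type `Θ_b` in every diagonal block (all places `t`), it contains every two-cycle face. [folklore] -/
theorem twoCycle_obligation_of_reps (hcH : c ∈ H) (hcen : ∀ g : G, g * c = c * g) (hc2 : c * c = 1) (hH : H.index = 2) {x : G}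
    (hx : x ∉ H) (hxx : x * x = 1) (N : Submodule ℤ (CMF G c →₀ ℤ)) (hN : ∀ Q : G, ∀ y ∈ N, Finsupp.mapDomain (rt c Q) y ∈ N)
    (rep : Block c → CMF G c) (hrep : ∀ b : Block c, blk c (rep b) = b)
    (hq : ∀ b : Block c, res₁ hcH hcen x (rep b) = res₀ hcH (rep b) → ∀ t : H, gface c hc2 (rep b) (t : G) (x * (t : G)) ∈ N)
    (Θ : CMF G c) (hΘ : res₁ hcH hcen x Θ = res₀ hcH Θ) (t : H) : gface c hc2 Θ (t : G) (x * (t : G)) ∈ N := by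
  obtain ⟨Q, hQ⟩ := exists_rt_eq_of_blk_eq c (show blk c Θ = blk c (rep (blk c Θ)) by rw [hrep])
  obtain ⟨t', ht'⟩ := exists_twoCycle_mem_iff_of_rt hc2 hH hx hxx N hN Q Θ t
  rw [ht', hQ]
  exact hq _ (by rw [← hQ]; exact diagonal_rt hcH hcen hc2 hH hx hxx Q hΘ) t'

/-! ## §2 Mixed faces and square elements under base change along `H` -/

omit [DecidablePred (· ∈ H)] in
/-- **Base change along `h ∈ H` of a mixed face**: `(gface Ψ k (x l))·h⁻¹ = gface (Ψ·h⁻¹) (k h⁻¹) (x (l h⁻¹))`. [folklore] -/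
theorem mapDomain_rt_coe_mixed (hc2 : c * c = 1) (x : G) (Ψ : CMF G c) (k l h : H) :
    Finsupp.mapDomain (rt c (h : G)) (gface c hc2 Ψ (k : G) (x * (l : G))) =
      gface c hc2 (rt c (h : G) Ψ) ((k * h⁻¹ : H) : G) (x * ((l * h⁻¹ : H) : G)) := by
  rw [mapDomain_rt_gface]
  simp [mul_assoc]

/-- **Deviations go to deviations** under base change along `h ∈ H`: `d ∈ res₁ Ψ ∖ res₀ Ψ ↔ d h⁻¹ ∈ res₁ (Ψ·h⁻¹) ∖ res₀ (Ψ·h⁻¹)`. [folklore] -/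
theorem dev_rt_coe (hcH : c ∈ H) (hcen : ∀ g : G, g * c = c * g) (x : G) (Ψ : CMF G c) (d h : H) :
    (d * h⁻¹ ∈ (res₁ hcH hcen x (rt c (h : G) Ψ)).1 ↔ d ∈ (res₁ hcH hcen x Ψ).1) ∧
    (d * h⁻¹ ∈ (res₀ hcH (rt c (h : G) Ψ)).1 ↔ d ∈ (res₀ hcH Ψ).1) := by
  rw [res₁_rt_coe, res₀_rt_coe, mem_rt, mem_rt, inv_mul_cancel_right]
  exact ⟨Iff.rfl, Iff.rfl⟩

omit [DecidablePred (· ∈ H)] in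
/-- **Square elements transport along `H`**: for base-change-stable `N`,
`gface Ψ k (x l) − gface Ψ l (x k) ∈ N ↔ gface (Ψ·h⁻¹) (k h⁻¹) (x (l h⁻¹)) − gface (Ψ·h⁻¹) (l h⁻¹) (x (k h⁻¹)) ∈ N`. [folklore] -/
theorem square_mem_iff_of_rt_coe (hc2 : c * c = 1) (x : G) (N : Submodule ℤ (CMF G c →₀ ℤ))
    (hN : ∀ Q : G, ∀ y ∈ N, Finsupp.mapDomain (rt c Q) y ∈ N) (Ψ : CMF G c) (k l h : H) :
    gface c hc2 Ψ (k : G) (x * (l : G)) - gface c hc2 Ψ (l : G) (x * (k : G)) ∈ N ↔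
      gface c hc2 (rt c (h : G) Ψ) ((k * h⁻¹ : H) : G) (x * ((l * h⁻¹ : H) : G)) -
        gface c hc2 (rt c (h : G) Ψ) ((l * h⁻¹ : H) : G) (x * ((k * h⁻¹ : H) : G)) ∈ N := by
  have key : ∀ (y : CMF G c →₀ ℤ), (y ∈ N ↔ Finsupp.mapDomain (rt c (h : G)) y ∈ N) := fun y =>
    ⟨hN (h : G) y, fun h' => by simpa [mapDomain_rt_inv_mapDomain_rt] using hN ((h : G))⁻¹ _ h'⟩
  rw [key, Finsupp.mapDomain_sub, mapDomain_rt_coe_mixed, mapDomain_rt_coe_mixed]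

/-! ## §3 Square elements under base change along `x·h` (split case): reduction to one type per distance-2 block -/

omit [DecidablePred (· ∈ H)] in
/-- A face depends on its places only: replacing the first place element `t` by `c·t` does not change it. [folklore] -/
theorem gface_cmul_fst (hc2 : c * c = 1) (Φ : CMF G c) (t t' : G) : gface c hc2 Φ (c * t) t' = gface c hc2 Φ t t' := by
  unfold gface; simp only [oflipCM_cmul]

omit [DecidablePred (· ∈ H)] in
/-- … nor does replacing the second place element `t'` by `c·t'`. [folklore] -/
theorem gface_cmul_snd (hc2 : c * c = 1) (Φ : CMF G c) (t t' : G) : gface c hc2 Φ t (c * t') = gface c hc2 Φ t t' := by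
  unfold gface; simp only [oflipCM_cmul]

omit [DecidablePred (· ∈ H)] in
/-- **Base change along `x·h` of a mixed face** (split case `x·x = 1`): the places swap cosets; with `σ m = x m h⁻¹ x ∈ H`,
`(gface Ψ k (x l))·(x h)⁻¹ = gface (Ψ·(x h)⁻¹) (σ l) (x (σ k))`. [folklore] -/
theorem mapDomain_rt_xmul_mixed (hc2 : c * c = 1) (hH : H.index = 2) {x : G} (hx : x ∉ H) (hxx : x * x = 1) (Ψ : CMF G c)
    (k l h : H) :
    Finsupp.mapDomain (rt c (x * (h : G))) (gface c hc2 Ψ (k : G) (x * (l : G))) =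
      gface c hc2 (rt c (x * (h : G)) Ψ) ((⟨x * ((l * h⁻¹ : H) : G) * x, mul_mul_mem hH hx _⟩ : H) : G)
        (x * ((⟨x * ((k * h⁻¹ : H) : G) * x, mul_mul_mem hH hx _⟩ : H) : G)) := by
  rw [mapDomain_rt_gface, gface_comm]
  have hxinv : x⁻¹ = x := inv_eq_of_mul_eq_one_right hxx
  congr 1
  · simp only [Subgroup.coe_mul, Subgroup.coe_inv, mul_inv_rev, hxinv, mul_assoc]
  · simp only [Subgroup.coe_mul, Subgroup.coe_inv, mul_inv_rev, hxinv, ← mul_assoc, hxx, one_mul]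

/-- **Deviations under base change along `x·h`**: if `m ∈ res₁ Ψ ∖ res₀ Ψ` then `c·σ m ∈ res₁ (Ψ·(x h)⁻¹) ∖ res₀ (Ψ·(x h)⁻¹)` (the swap exchanges
the two coordinates, the factor `c` moves to the other element of the place). [folklore] -/
theorem dev_rt_xmul (hcH : c ∈ H) (hcen : ∀ g : G, g * c = c * g) (hH : H.index = 2) {x : G} (hx : x ∉ H)
    (hxx : x * x = 1) (Ψ : CMF G c) (m h : H) (hm1 : m ∈ (res₁ hcH hcen x Ψ).1) (hm0 : m ∉ (res₀ hcH Ψ).1) :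
    (⟨c, hcH⟩ * ⟨x * ((m * h⁻¹ : H) : G) * x, mul_mul_mem hH hx _⟩ : H) ∈ (res₁ hcH hcen x (rt c (x * (h : G)) Ψ)).1 ∧
    (⟨c, hcH⟩ * ⟨x * ((m * h⁻¹ : H) : G) * x, mul_mul_mem hH hx _⟩ : H) ∉ (res₀ hcH (rt c (x * (h : G)) Ψ)).1 := by
  rw [mem_res₁, mem_res₀] at *
  have hsq : x * (x * ((m : G) * (h : G)⁻¹) * x) * (x * (h : G)) = (m : G) := by
    rw [show x * (x * ((m : G) * (h : G)⁻¹) * x) * (x * (h : G)) = (x * x) * ((m : G) * (h : G)⁻¹) * (x * x) * (h : G) by group,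
      hxx]
    group
  have e1 : x * (c * (x * ((m : G) * (h : G)⁻¹) * x)) * (x * (h : G)) = c * (m : G) := by
    rw [← mul_assoc x c, hcen x, mul_assoc c x, mul_assoc c, hsq]
  have e0 : c * (x * ((m : G) * (h : G)⁻¹) * x) * (x * (h : G)) = c * (x * (m : G)) := by
    rw [show c * (x * ((m : G) * (h : G)⁻¹) * x) * (x * (h : G)) = c * (x * ((m : G) * ((h : G)⁻¹ * ((x * x) * (h : G))))) by group,
      hxx, one_mul, inv_mul_cancel, mul_one]
  constructor
  · rw [mem_rt]
    change x * (c * (x * ((m : G) * ((h : G))⁻¹) * x)) * (x * (h : G)) ∈ Ψ.1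
    rw [e1]
    -- `c·m ∈ Ψ ↔ m ∉ Ψ`
    by_contra hcm
    exact hm0 ((Ψ.2 (m : G)).mpr hcm)
  · rw [mem_rt]
    change c * (x * ((m : G) * ((h : G))⁻¹) * x) * (x * (h : G)) ∉ Ψ.1
    rw [e0]
    exact (Ψ.2 (x * (m : G))).mp hm1

omit [DecidablePred (· ∈ H)] in
/-- **Square elements transport along `x·h`** (split case): with `σ m = x m h⁻¹ x`,
`(gface Ψ k (x l) − gface Ψ l (x k))·(x h)⁻¹ = −(gface Ψ' (c σ k) (x (c σ l)) − gface Ψ' (c σ l) (x (c σ k)))`, `Ψ' = Ψ·(x h)⁻¹`. [folklore] -/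
theorem mapDomain_rt_xmul_square (hcH : c ∈ H) (hcen : ∀ g : G, g * c = c * g) (hc2 : c * c = 1) (hH : H.index = 2) {x : G}
    (hx : x ∉ H) (hxx : x * x = 1) (Ψ : CMF G c) (k l h : H) :
    Finsupp.mapDomain (rt c (x * (h : G))) (gface c hc2 Ψ (k : G) (x * (l : G)) - gface c hc2 Ψ (l : G) (x * (k : G))) =
      -(gface c hc2 (rt c (x * (h : G)) Ψ) ((⟨c, hcH⟩ * ⟨x * ((k * h⁻¹ : H) : G) * x, mul_mul_mem hH hx _⟩ : H) : G)
          (x * ((⟨c, hcH⟩ * ⟨x * ((l * h⁻¹ : H) : G) * x, mul_mul_mem hH hx _⟩ : H) : G)) -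
        gface c hc2 (rt c (x * (h : G)) Ψ) ((⟨c, hcH⟩ * ⟨x * ((l * h⁻¹ : H) : G) * x, mul_mul_mem hH hx _⟩ : H) : G)
          (x * ((⟨c, hcH⟩ * ⟨x * ((k * h⁻¹ : H) : G) * x, mul_mul_mem hH hx _⟩ : H) : G))) := by
  rw [Finsupp.mapDomain_sub, mapDomain_rt_xmul_mixed hc2 hH hx hxx, mapDomain_rt_xmul_mixed hc2 hH hx hxx]
  have hxc : ∀ Y : G, x * (c * Y) = c * (x * Y) := fun Y => by rw [← mul_assoc, hcen x, mul_assoc]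
  simp only [Subgroup.coe_mul, hxc, gface_cmul_fst, gface_cmul_snd]
  abel

omit [DecidablePred (· ∈ H)] in
/-- **Square obligations transport along `x·h`**: for base-change-stable `N`, the square element at `Ψ` with deviations `k, l` lies in `N` iff the
square element at `Ψ·(x h)⁻¹` with deviations `c σ k, c σ l` does. [folklore] -/
theorem square_mem_iff_of_rt_xmul (hcH : c ∈ H) (hcen : ∀ g : G, g * c = c * g) (hc2 : c * c = 1) (hH : H.index = 2) {x : G}
    (hx : x ∉ H) (hxx : x * x = 1) (N : Submodule ℤ (CMF G c →₀ ℤ)) (hN : ∀ Q : G, ∀ y ∈ N, Finsupp.mapDomain (rt c Q) y ∈ N)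
    (Ψ : CMF G c) (k l h : H) :
    gface c hc2 Ψ (k : G) (x * (l : G)) - gface c hc2 Ψ (l : G) (x * (k : G)) ∈ N ↔
      gface c hc2 (rt c (x * (h : G)) Ψ) ((⟨c, hcH⟩ * ⟨x * ((k * h⁻¹ : H) : G) * x, mul_mul_mem hH hx _⟩ : H) : G)
          (x * ((⟨c, hcH⟩ * ⟨x * ((l * h⁻¹ : H) : G) * x, mul_mul_mem hH hx _⟩ : H) : G)) -
        gface c hc2 (rt c (x * (h : G)) Ψ) ((⟨c, hcH⟩ * ⟨x * ((l * h⁻¹ : H) : G) * x, mul_mul_mem hH hx _⟩ : H) : G)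
          (x * ((⟨c, hcH⟩ * ⟨x * ((k * h⁻¹ : H) : G) * x, mul_mul_mem hH hx _⟩ : H) : G)) ∈ N := by
  have key : ∀ (y : CMF G c →₀ ℤ), (y ∈ N ↔ Finsupp.mapDomain (rt c (x * (h : G))) y ∈ N) := fun y =>
    ⟨hN _ y, fun h' => by have h'' := hN (x * (h : G))⁻¹ _ h'; rwa [mapDomain_rt_inv_mapDomain_rt] at h''⟩
  rw [key, mapDomain_rt_xmul_square hcH hcen hc2 hH hx hxx, Submodule.neg_mem_iff]

/-- **Square obligations reduce to one type per distance-2 block** (split case): if `N` is base-change stable and contains the square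
elements `gface Ψ_b k (x l) − gface Ψ_b l (x k)` for ONE type `Ψ_b` in every block of distance `2` (all ordered pairs of distinct deviations
`k, l`), it contains every square element. [folklore] -/
theorem square_obligation_of_reps (hcH : c ∈ H) (hcen : ∀ g : G, g * c = c * g) (hc2 : c * c = 1) (hH : H.index = 2) {x : G}
    (hx : x ∉ H) (hxx : x * x = 1) (N : Submodule ℤ (CMF G c →₀ ℤ)) (hN : ∀ Q : G, ∀ y ∈ N, Finsupp.mapDomain (rt c Q) y ∈ N)
    (rep : Block c → CMF G c) (hrep : ∀ b : Block c, blk c (rep b) = b)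
    (hr : ∀ b : Block c, wt (⟨c, hcH⟩ : H) (res₁ hcH hcen x (rep b)) (res₀ hcH (rep b)) = 2 → ∀ k l : H,
      k ∈ (res₁ hcH hcen x (rep b)).1 → k ∉ (res₀ hcH (rep b)).1 → l ∈ (res₁ hcH hcen x (rep b)).1 → l ∉ (res₀ hcH (rep b)).1 → k ≠ l →
      gface c hc2 (rep b) (k : G) (x * (l : G)) - gface c hc2 (rep b) (l : G) (x * (k : G)) ∈ N)
    (Ψ : CMF G c) (h2 : wt (⟨c, hcH⟩ : H) (res₁ hcH hcen x Ψ) (res₀ hcH Ψ) = 2) (k l : H)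
    (hk1 : k ∈ (res₁ hcH hcen x Ψ).1) (hk0 : k ∉ (res₀ hcH Ψ).1) (hl1 : l ∈ (res₁ hcH hcen x Ψ).1) (hl0 : l ∉ (res₀ hcH Ψ).1)
    (hkl : k ≠ l) : gface c hc2 Ψ (k : G) (x * (l : G)) - gface c hc2 Ψ (l : G) (x * (k : G)) ∈ N := by
  obtain ⟨Q, hQ⟩ := exists_rt_eq_of_blk_eq c (show blk c Ψ = blk c (rep (blk c Ψ)) by rw [hrep])
  have hD : wt (⟨c, hcH⟩ : H) (res₁ hcH hcen x (rt c Q Ψ)) (res₀ hcH (rt c Q Ψ)) = 2 := by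
    rw [wt_res_rt hcH hcen hc2 hH hx hxx]; exact h2
  by_cases hQH : Q ∈ H
  · obtain ⟨q, rfl⟩ : ∃ q : H, (q : G) = Q := ⟨⟨Q, hQH⟩, rfl⟩
    rw [square_mem_iff_of_rt_coe hc2 x N hN Ψ k l q, hQ]
    have dk := dev_rt_coe hcH hcen x Ψ k q
    have dl := dev_rt_coe hcH hcen x Ψ l q
    rw [hQ] at dk dl
    exact hr _ (hQ ▸ hD) _ _ (dk.1.mpr hk1) (fun h => hk0 (dk.2.mp h)) (dl.1.mpr hl1) (fun h => hl0 (dl.2.mp h))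
      (fun h => hkl (mul_right_cancel h))
  · obtain ⟨h, rfl⟩ := exists_eq_mul_of_not_mem hH hx hQH
    rw [square_mem_iff_of_rt_xmul hcH hcen hc2 hH hx hxx N hN Ψ k l h, hQ]
    have dk := dev_rt_xmul hcH hcen hH hx hxx Ψ k h hk1 hk0
    have dl := dev_rt_xmul hcH hcen hH hx hxx Ψ l h hl1 hl0
    rw [hQ] at dk dl
    refine hr _ (hQ ▸ hD) _ _ dk.1 dk.2 dl.1 dl.2 fun heq => hkl ?_
    have h1 := congrArg (fun u : H => ((⟨c, hcH⟩ : H)⁻¹ * u : H)) heq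
    simp only [inv_mul_cancel_left] at h1
    have h2 : x * ((k * h⁻¹ : H) : G) * x = x * ((l * h⁻¹ : H) : G) * x := congrArg Subtype.val h1
    have h3 : ((k * h⁻¹ : H) : G) = ((l * h⁻¹ : H) : G) := by
      have := congrArg (fun g => x * g * x) h2
      simpa [← mul_assoc, hxx, mul_assoc, one_mul, mul_one] using this
    exact mul_right_cancel (Subtype.ext h3)

/-! ## §4 The checklist on block representatives -/

/-- **THE CHECKLIST ON BLOCK REPRESENTATIVES** (split case `x·x = 1`) — the form a census seat applies.  Let `rep : Block c → CMF G c` pick one type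
per block.  A base-change-stable `N ≤ hodgeSpan (G, c)` containing the pairs is ALL of `hodgeSpan (G, c)` as soon as it holds
(1) a lift of every member of an `H`-generating family `S`; (2) at every representative of distance `≥ 2` ONE distance-lowering mixed face;
(3) at every representative of distance `0` the two-cycle faces `gface (rep b) t (x t)`; (4) at every representative of distance `2` the square
elements. [folklore] -/
theorem hodgeSpan_le_of_rep_checklist (hcH : c ∈ H) (hc2 : c * c = 1) (hc1 : c ≠ 1) (hcen : ∀ g : G, g * c = c * g) (hH : H.index = 2)
    {x : G} (hx : x ∉ H) (hxx : x * x = 1) (S : Finset (CMF H ⟨c, hcH⟩ →₀ ℤ))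
    (hS : hodgeSpan (⟨c, hcH⟩ : H) (csub_mul_csub hcH hc2) ≤
      Submodule.span ℤ (pairSet (⟨c, hcH⟩ : H)) ⊔ Submodule.span ℤ (translates (⟨c, hcH⟩ : H) S))
    (N : Submodule ℤ (CMF G c →₀ ℤ)) (hNH : N ≤ hodgeSpan c hc2) (hN : ∀ Q : G, ∀ y ∈ N, Finsupp.mapDomain (rt c Q) y ∈ N)
    (hP : Submodule.span ℤ (pairSet c) ≤ N)
    (hlift : ∀ f ∈ S, ∃ F ∈ N, marg₀ hcH F = f ∧ marg₁ hcH hcen x F = 0)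
    (rep : Block c → CMF G c) (hrep : ∀ b : Block c, blk c (rep b) = b)
    (hdesc : ∀ b : Block c, 2 ≤ wt (⟨c, hcH⟩ : H) (res₁ hcH hcen x (rep b)) (res₀ hcH (rep b)) → ∃ d d' : H,
      gface c hc2 (rep b) (d : G) (x * (d' : G)) ∈ N ∧
      wt (⟨c, hcH⟩ : H) (res₁ hcH hcen x (oflipCM c hc2 (d : G) (rep b))) (res₀ hcH (oflipCM c hc2 (d : G) (rep b))) <
        wt (⟨c, hcH⟩ : H) (res₁ hcH hcen x (rep b)) (res₀ hcH (rep b)) ∧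
      wt (⟨c, hcH⟩ : H) (res₁ hcH hcen x (oflipCM c hc2 (x * (d' : G)) (rep b))) (res₀ hcH (oflipCM c hc2 (x * (d' : G)) (rep b))) <
        wt (⟨c, hcH⟩ : H) (res₁ hcH hcen x (rep b)) (res₀ hcH (rep b)) ∧
      wt (⟨c, hcH⟩ : H) (res₁ hcH hcen x (oflipCM c hc2 (d : G) (oflipCM c hc2 (x * (d' : G)) (rep b))))
          (res₀ hcH (oflipCM c hc2 (d : G) (oflipCM c hc2 (x * (d' : G)) (rep b)))) <
        wt (⟨c, hcH⟩ : H) (res₁ hcH hcen x (rep b)) (res₀ hcH (rep b)))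
    (hq : ∀ b : Block c, res₁ hcH hcen x (rep b) = res₀ hcH (rep b) → ∀ t : H, gface c hc2 (rep b) (t : G) (x * (t : G)) ∈ N)
    (hr : ∀ b : Block c, wt (⟨c, hcH⟩ : H) (res₁ hcH hcen x (rep b)) (res₀ hcH (rep b)) = 2 → ∀ k l : H,
      k ∈ (res₁ hcH hcen x (rep b)).1 → k ∉ (res₀ hcH (rep b)).1 → l ∈ (res₁ hcH hcen x (rep b)).1 → l ∉ (res₀ hcH (rep b)).1 → k ≠ l →
      gface c hc2 (rep b) (k : G) (x * (l : G)) - gface c hc2 (rep b) (l : G) (x * (k : G)) ∈ N) :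
    hodgeSpan c hc2 ≤ N := by
  refine hodgeSpan_le_of_checklist hcH hc2 hc1 hcen hH hx hxx S hS N hNH hN hP hlift ?_ ?_ ?_
  · intro Ψ h2
    obtain ⟨Q, hQ⟩ := exists_rt_eq_of_blk_eq c (show blk c Ψ = blk c (rep (blk c Ψ)) by rw [hrep])
    have h2' : 2 ≤ wt (⟨c, hcH⟩ : H) (res₁ hcH hcen x (rep (blk c Ψ))) (res₀ hcH (rep (blk c Ψ))) := by
      rw [← hQ, wt_res_rt hcH hcen hc2 hH hx hxx]; exact h2
    obtain ⟨d, d', hmem, e1, e2, e3⟩ := hdesc _ h2'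
    exact ⟨Q, d, d', by rw [hQ]; exact hmem, by rw [hQ]; exact e1, by rw [hQ]; exact e2, by rw [hQ]; exact e3⟩
  · exact fun Θ t hΘ => twoCycle_obligation_of_reps hcH hcen hc2 hH hx hxx N hN rep hrep hq Θ hΘ t
  · exact fun Ψ k l h2 hk1 hk0 hl1 hl0 hkl => square_obligation_of_reps hcH hcen hc2 hH hx hxx N hN rep hrep hr Ψ h2 k l hk1 hk0 hl1 hl0 hkl

end

end Summit.HodgeConjecture.CorCM.Census.IndexTwoDescent
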